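import Summits.ResolutionOfSingularities.ResolutionOfSingularities.Theorems.EquisingularLiftEquisingularLiftNatTowerBDoublePrimeRoundClosure
import HarnessLib

/-!
# [OURS · L1 W4.5(b) · EL♮(3) · T23-A/A″] THE POINT-STEP CLOSURES OF THE B-TOWERS ON THE ENGINE INVARIANT AT THE DATUM «`V(𝓔)` IS `O`-FLAT»
# — `TowerPtRegB` / `TowerPtRamB` on `INV₁ := (Tower.InvB FE … ∧ K-side facts) ∧ hcar ∧ IsLocallyNoetherian F₉` as standalone theorems

res-L1-w45b-stub-4 g11 (T23-A / A′ / A″ engine owner). Crux EL♮(3) = stmt-ResolutionOfSingularities-20148 (parent stmt-…-20038). OURS; NOT a statement of any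
manuscript ([Hironaka2017] is a candidate under adjudication, nothing of it is asserted); AI-written, weaker than expert review. DEF-FREE; no `sorry`; standard
axioms. `--supports stmt-ResolutionOfSingularities-20148 --as helper`.

WHAT. The `(pt-reg)` / `(pt-ram)` arms of the assemblies V10 / V10′ / V10″ (…NatTowerBAssembly, …NatTowerBPrimeAssembly, …NatTowerBDoublePrimeAssembly) are the
same 25-line blocks each time (`Tower.towerPtRegB_invB` / `Tower.towerPtRamB_invB` of …NatTowerBPointSteps at `Ruled := FE` + the shadow's side facts); here they
are ONCE, as `Tower.towerPtRegB_invB₁_FE` / `Tower.towerPtRamB_invB₁_FE`, for the next assemblies (V10‴ = the A″-S engine, engine word 16d03a46d50c8ccd §S) to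
cite by name together with the round closure `Tower.towerRoundBDoublePrime_invB_of_fact'` (…NatTowerBDoublePrimeRoundClosure) and `Tower.invB_final`.
Bodies = res-L1-w45b-stub-2's V10″ arms VERBATIM (adapted copy). [cite: GortzWedhorn2020, (13.19) and Prop. 13.91]
-/

set_option linter.dupNamespace false -- mandated namespace `Summit.<Summit>.<Problem>` of this single-conjunct summit
set_option linter.overlappingInstances false -- signatures carry `[IsDomain O] [IsDiscreteValuationRing O]`

noncomputable section

open CategoryTheory CategoryTheory.Limits AlgebraicGeometry TopologicalSpace Topology IsLocalRing
open Literature.AlgebraicGeometry.Resolution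
open AlgebraicGeometry.Scheme.IdealSheafData
open Summit.ResolutionOfSingularities.ResolutionOfSingularities.Theses.EquisingularLift.Split
open Summit.ResolutionOfSingularities.ResolutionOfSingularities.Cruxes.EquisingularLift.StrataSplit

namespace Summit.ResolutionOfSingularities.ResolutionOfSingularities.Cruxes.EquisingularLiftNat.Sections

section PtFE

variable (O : Type) [CommRing O] [IsDomain O] [IsDiscreteValuationRing O] [IsAdicComplete (IsLocalRing.maximalIdeal O) O]
    [IsAlgClosed (IsLocalRing.ResidueField O)] (k : Type) [Field k]
    (θ : O →+* k) (hθ : Function.Surjective θ)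
    (P : Scheme.{0}) [IsIntegral P] (q : P ⟶ Spec (.of O)) [IsProper q] [SmoothOfRelativeDimension 3 q] (Y : Set P)
    (hYsp : Y ⊆ q ⁻¹' {IsLocalRing.closedPoint O}) (hYirr : IsIrreducible Y) (hYcl : IsClosed Y)
    (hPnoeth : IsLocallyNoetherian P) (hPreg : Scheme.IsRegular P)
    (Ch : ∀ X' : Scheme.{0}, (X' ⟶ P) → Set X' → Prop)
    (hChStep : ∀ (X' X'' : Scheme.{0}) (σ' : X' ⟶ P) (S' : Set X') (C : X'.IdealSheafData) (τ : X'' ⟶ X'),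
      Ch X' σ' S' → IsBlowup τ C → Scheme.IsRegular C.subscheme → Flat (C.subschemeι ≫ σ' ≫ q) →
      σ' '' (C.support : Set X') ⊆ {y | ¬ IsGenericPoint y Y} → (C.support : Set X') ∩ (σ' ≫ q) ⁻¹' {IsLocalRing.closedPoint O} ⊆ S' →
      Ch X'' (τ ≫ σ') (closure (τ ⁻¹' (S' \ (C.support : Set X')))))
    (hChSplit : ∀ (X' : Scheme.{0}) (σ' : X' ⟶ P) (S' : Set X'), Ch X' σ' S' → Chain P Y X' σ' S')

omit [IsDomain O] [IsDiscreteValuationRing O] [IsIntegral P] [IsProper q] [SmoothOfRelativeDimension 3 q]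
  [IsAdicComplete (IsLocalRing.maximalIdeal O) O] [IsAlgClosed (IsLocalRing.ResidueField O)] in
/-- The datum `FE := «V(𝓔) is O-flat»` is invariant along an isomorphism of subschemes over the step — the shape `Tower.towerPtRegB_invB` consumes.
[OURS · pure repackaging] -/
theorem Tower.feIsoC :
    ∀ {F₉ : Scheme.{0}} (Z₉ : Set F₉) (hZ₉ : IsClosed Z₉) {F₁₀ : Scheme.{0}} (υ' : F₁₀ ⟶ F₉),
      ∀ (G₀ G₀' : Scheme.{0}) (γ₀ : G₀ ⟶ F₁₀) (γ₀' : G₀' ⟶ F₁₀) (E₀ : Set G₀) (E₀' : Set G₀') (X₀ X₀'' : Scheme.{0})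
        (σ₀ : X₀ ⟶ P) (j₀ : G₀ ⟶ X₀) (j₀' : G₀' ⟶ X₀'') (𝓔₀ : X₀.IdealSheafData) (τ₀ : X₀'' ⟶ X₀),
      (∃ e : (𝓔₀.comap τ₀).subscheme ≅ 𝓔₀.subscheme, e.hom ≫ 𝓔₀.subschemeι = (𝓔₀.comap τ₀).subschemeι ≫ τ₀) →
      (fun _ _ _ _ _ _ _ _ _ σ _ 𝓔 => Flat (𝓔.subschemeι ≫ σ ≫ q) : Tower.RuledDatum P) F₉ Z₉ hZ₉ F₁₀ υ' G₀ γ₀ E₀ X₀ σ₀ j₀ 𝓔₀ →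
      (fun _ _ _ _ _ _ _ _ _ σ _ 𝓔 => Flat (𝓔.subschemeι ≫ σ ≫ q) : Tower.RuledDatum P) F₉ Z₉ hZ₉ F₁₀ υ' G₀' γ₀' E₀' X₀'' (τ₀ ≫ σ₀) j₀'
        (𝓔₀.comap τ₀) := by
  intro F₉ Z₉ hZ₉ F₁₀ υ' G₀ G₀' γ₀ γ₀' E₀ E₀' X₀ X₀'' σ₀ j₀ j₀' 𝓔₀ τ₀ he hflat
  obtain ⟨e, he⟩ := he
  have hflat' : Flat (𝓔₀.subschemeι ≫ σ₀ ≫ q) := hflat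
  have heq : (𝓔₀.comap τ₀).subschemeι ≫ (τ₀ ≫ σ₀) ≫ q = e.hom ≫ 𝓔₀.subschemeι ≫ σ₀ ≫ q := by
    rw [← Category.assoc e.hom, he]; simp only [Category.assoc]
  show Flat ((𝓔₀.comap τ₀).subschemeι ≫ (τ₀ ≫ σ₀) ≫ q)
  rw [heq]
  infer_instance

include hθ hYsp hYirr hYcl hPnoeth hPreg hChStep hChSplit

omit [IsIntegral P] [SmoothOfRelativeDimension 3 q] in
/-- **`(pt-reg)` on the engine invariant at `FE`** (V10's `INV₁`): res-L1-w45b-stub-2's V10″ arm VERBATIM. [OURS · L1 W4.5b · T23-A engine]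
toward `stub_elnat_defTowerBDoublePrime(S)PointResolutionThree`; NOT a statement of the manuscript. -/
theorem Tower.towerPtRegB_invB₁_FE :
    ∀ (F₉ : Scheme.{0}) (Z₉ : Set F₉) (hZ₉ : IsClosed Z₉) (F₁₀ : Scheme.{0}) (υ' : F₁₀ ⟶ F₉),
      TowerPtRegB F₉ F₁₀ υ' (fun G γ T E Es K =>
        (Tower.InvB O k θ P q Y Ch (fun _ _ _ _ _ _ _ _ _ σ _ 𝓔 => Flat (𝓔.subschemeι ≫ σ ≫ q)) F₉ Z₉ hZ₉ F₁₀ υ' G γ T E Es K ∧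
          IsClosed K ∧ K ⊆ closure (K \ E) ∧ K ≠ Set.univ) ∧
        (∀ z : ↥(redSub F₉ Z₉ hZ₉), IsClosed ({z} : Set ↥(redSub F₉ Z₉ hZ₉)) →
          ringKrullDim ((redSub F₉ Z₉ hZ₉).presheaf.stalk z) = ((1 : ℕ) : WithBot ℕ∞)) ∧ IsLocallyNoetherian F₉) := by
  intro F₉ Z₉ hZ₉ F₁₀ υ' G G' γ T E Es K y υ₂ hy K' E' Es' hinv hTreg hGreg hυ₂ hK' hE' hEs'
  obtain ⟨⟨hinv, hKcl, hKE, hKne⟩, hcar, hF₉noeth⟩ := hinv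
  have hI₂ := Tower.towerPtRegB_invB O k θ hθ P q Y hYsp hYirr hYcl hPnoeth hPreg Ch hChSplit hChStep _ F₉ Z₉ hZ₉ F₁₀ υ'
    (Tower.feIsoC O P q Z₉ hZ₉ υ') G G' γ T E Es K y υ₂ hy K' E' Es' hinv hTreg
    hGreg hυ₂ hK' hE' hEs'
  refine (fun h3 => ⟨⟨hI₂, h3⟩, hcar, hF₉noeth⟩) ?_
  obtain ⟨-, -, hGint, -, hTirr, hEcl, hTE, -⟩ := hinv
  obtain ⟨-, -, hG'int, -⟩ := hI₂
  haveI := hGint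
  haveI := hG'int
  have hTy : ¬ T ⊆ {curvePt G T y} := not_subset_singleton_of_not_isRegularLocalRing_stalk y hTreg hy
  have hDsupp : ((vanishingIdeal (⟨{curvePt G T y}, hy⟩ : Closeds G) : G.IdealSheafData).support : Set G) = {curvePt G T y} :=
    Scheme.IdealSheafData.coe_support_vanishingIdeal _
  rcases hK' with rfl | ⟨hyK, rfl⟩
  · exact ⟨isClosed_empty, by simp, Set.empty_ne_univ⟩
  · refine ⟨isClosed_closure, ?_, closure_preimage_ne_univ υ₂ _ hυ₂ K {curvePt G T y} hKcl hKne hy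
      (fun h => hTy (h ▸ Set.subset_univ _)) hDsupp.le _ (Set.preimage_mono fun z hz => hz.1)⟩
    rcases hE' with rfl | ⟨-, rfl⟩
    · exact closure_preimage_diff_subset_closure_diff_preimage υ₂ K {curvePt G T y}
    · have h := closure_preimage_diff_subset_of_isBlowup υ₂ (vanishingIdeal (⟨{curvePt G T y}, hy⟩ : Closeds G)) hυ₂ K E hEcl hKE
      rw [hDsupp] at h
      exact h

/-- **`(pt-ram)` on the engine invariant at `FE`** (V10's `INV₁`): res-L1-w45b-stub-2's V10″ arm VERBATIM. [OURS · L1 W4.5b · T23-A engine]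
toward `stub_elnat_defTowerBDoublePrime(S)PointResolutionThree`; NOT a statement of the manuscript. -/
theorem Tower.towerPtRamB_invB₁_FE :
    ∀ (F₉ : Scheme.{0}) (Z₉ : Set F₉) (hZ₉ : IsClosed Z₉) (F₁₀ : Scheme.{0}) (υ' : F₁₀ ⟶ F₉),
      TowerPtRamB F₉ F₁₀ υ' (fun G γ T E Es K =>
        (Tower.InvB O k θ P q Y Ch (fun _ _ _ _ _ _ _ _ _ σ _ 𝓔 => Flat (𝓔.subschemeι ≫ σ ≫ q)) F₉ Z₉ hZ₉ F₁₀ υ' G γ T E Es K ∧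
          IsClosed K ∧ K ⊆ closure (K \ E) ∧ K ≠ Set.univ) ∧
        (∀ z : ↥(redSub F₉ Z₉ hZ₉), IsClosed ({z} : Set ↥(redSub F₉ Z₉ hZ₉)) →
          ringKrullDim ((redSub F₉ Z₉ hZ₉).presheaf.stalk z) = ((1 : ℕ) : WithBot ℕ∞)) ∧ IsLocallyNoetherian F₉) := by
  intro F₉ Z₉ hZ₉ F₁₀ υ' G G' γ T E Es K y J υ₂ K' E' Es' hinv hTreg hGreg hJsupp hJgen hυ₂ hK' hE' hEs'
  obtain ⟨⟨hinv, hKcl, hKE, hKne⟩, hcar, hF₉noeth⟩ := hinv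
  have hI₂ := Tower.towerPtRamB_invB O k θ hθ P q Y hYsp hYirr hYcl hPnoeth hPreg Ch hChSplit hChStep _ F₉ Z₉ hZ₉ F₁₀ υ'
    (Tower.feIsoC O P q Z₉ hZ₉ υ') G G' γ T E Es K y J υ₂ K' E' Es' hinv hTreg
    hGreg hJsupp hJgen hυ₂ hK' hE' hEs'
  refine (fun h3 => ⟨⟨hI₂, h3⟩, hcar, hF₉noeth⟩) ?_
  obtain ⟨-, -, hGint, -, hTirr, hEcl, hTE, -⟩ := hinv
  obtain ⟨-, -, hG'int, -⟩ := hI₂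
  haveI := hGint
  haveI := hG'int
  have hyc : IsClosed ({curvePt G T y} : Set G) := hJsupp ▸ J.support.isClosed
  have hTy : ¬ T ⊆ {curvePt G T y} := not_subset_singleton_of_not_isRegularLocalRing_stalk y hTreg hyc
  rcases hK' with rfl | ⟨hyK, rfl⟩
  · exact ⟨isClosed_empty, by simp, Set.empty_ne_univ⟩
  · refine ⟨isClosed_closure, ?_, closure_preimage_ne_univ υ₂ _ hυ₂ K {curvePt G T y} hKcl hKne hyc
      (fun h => hTy (h ▸ Set.subset_univ _)) hJsupp.le _ (Set.preimage_mono fun z hz => hz.1)⟩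
    rcases hE' with rfl | ⟨-, rfl⟩
    · exact closure_preimage_diff_subset_closure_diff_preimage υ₂ K {curvePt G T y}
    · have h := closure_preimage_diff_subset_of_isBlowup υ₂ J hυ₂ K E hEcl hKE
      rw [hJsupp] at h
      exact h

end PtFE

end Summit.ResolutionOfSingularities.ResolutionOfSingularities.Cruxes.EquisingularLiftNat.Sections

end
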